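import Literature.NumberTheory.EllipticCurves.Kato2004.AdmissibleZetaClassRealisability
import Literature.NumberTheory.EllipticCurves.Kato2004.LocPKernelRankOnePlumbing
import Literature.NumberTheory.EllipticCurves.Disegni2020.PAdicBSDRankOneMultiplicativeProofs
import Literature.NumberTheory.EllipticCurves.GrossZagierRationalPoint
import Literature.NumberTheory.EllipticCurves.CanonicalPAdicHeightJunkSigmaProofs
import Literature.NumberTheory.EllipticCurves.MordellWeilTheoremProofs
import Literature.NumberTheory.EllipticCurves.TateModuleContinuityProofs
import Literature.NumberTheory.EllipticCurves.LeadingTerm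
import Literature.NumberTheory.EllipticCurves.Rank1Residual.Typed.Basic
import Summits.BirchSwinnertonDyer.Rank1Residual.Additive.KatoDescentGlobalKummerTamagawa
import Summits.BirchSwinnertonDyer.Rank1Residual.Additive.KatoDescentLocPKummerLogOfClass
import Summits.BirchSwinnertonDyer.BirchSwinnertonDyer.Theorems.CongruentShaFreeCutKatoKummerLogTorsion
import Summits.BirchSwinnertonDyer.Rank1Residual.Partition.Rows
import HarnessLib

/-!
# Route `ErratumRoadFive`, crux `EulerHalfNotRamNoInertSetAtFive` (stmt-BirchSwinnertonDyer-19715), line `kato_Fframe` r5.5 —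
# **the research stubs S3 / S3ns ATOMISED: their print conjuncts separated from the ONE research conjunct each (a pure
# valuation inequality)** — ROUTE-INDEPENDENT module (no `Theses` import; the crux-named corollaries live in
# `ErratumRoadFiveKatoFframeClosureAtomic`)

LEAD seat `bsd-line-er5-p1` (g10), `--supports stmt-BirchSwinnertonDyer-19715`; theorems only (no definition, no named fact, no
instance, no notation, no `sorry`). Each of the registered stubs S3 `stub_integralExcZeroValue` / S3ns `stub_integralNonsplitValue` of
`Cruxes/EulerHalfNotRamNoInertSetAtFive/Lines/kato_Fframe_r5.lean` is a FOUR-conjunct existential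
`∃ q t, shaAn W = q ∧ HasLocPKummerLog (bottom class of z₀) t ∧ t ≠ 0 ∧ ⟨valuation inequality⟩`. This file derives each from ATOMS:

1. `∃ t, HasLocPKummerLog W p (bottom class) t` — a THEOREM here (§1): in positive rank every integral class is Kummer at `p` (the
   tree's Kurihara–Pollack line `LocPKummer.hasLocPKummerLog_of_exists_log_ne_zero_of_mem_integralH1`, fed by the integral Kummer class
   of a point of infinite order, `GlobalKummer.exists_pow_smul_kummerTate_mem_integralH1_hasLocPKummerLog`), and the bottom class is
   integral (`Kato2004.layerZeroToTop_mem_integralH1`). No reciprocity law and no admissibility are needed.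
2. `∃ q : ℚ, shaAn W = q` — PRINT by name: Gross–Zagier I.(7.3) (`GrossZagier1986_thm_I_7_3`) with GZK, through the tree theorem
   `Disegni2020.exists_rat_shaAn_eq_of_analyticRank_eq_one`.
3. `t ≠ 0` — the NON-VANISHING OF KATO'S CLASS IN ANALYTIC RANK ONE at a multiplicative `p ≥ 5` with `ρ̄` onto — PRINT, as binders:
   `hNZsplit` = Venerucci, Invent. math. 203 (2016), Thm. A (2) with Thm. B [conductor `Np`, `p > 3` split multiplicative, `A_p`
   irreducible, `L(A,1) = 0`: «res_p(ζ^BK) ≠ 0 if and only if L(A/ℚ,s) has a simple zero at s = 1»; corpus paper:arxiv-1407.1913 p. 3];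
   `hNZnonsplit` = Bertolini–Darmon–Venerucci, Adv. Math. 398 (2022), Thm. A at odd `p`, `p² ∤ N` [the rational form of Perrin-Riou's
   conjecture; in particular «res_p(z_Kato) ≠ 0 iff ord_{s=1} L(E,s) = 1», transcription Kim, Math. Ann. 387 (2022) Thm. 2.1 / Cor. 2.3;
   BDV's own text is cite-only in the store, acq-02715]. In tree currency: every Kummer logarithm `t` of the bottom layer of an
   ADMISSIBLE class (`Kato2004.IsAdmissibleZetaClass` = Kato's `Ω_W`-normalised `𝐳_γ` up to `Λˣ`; non-vanishing is normalisation-free)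
   is `≠ 0`. Not typed as Literature named facts here (a typer may; then these binders are discharged by name).
4. the VALUATION INEQUALITY `ord_p t − 2·ord_p log_ω(x̂) ≤ ord_p q + ord_p ∏c_ℓ − 2·ord_p #E(ℚ)_tors − 1` for every such `t ≠ 0` and
   every rational `q = #Ш_an` — binders `hVsplit` / `hVnonsplit`: the ONLY research content of the line (integral rank-one Perrin-Riou
   values at split / non-split multiplicative `p`; NOT in print — workfile `Cruxes/…/Lines/kato_Fframe_r5_RESIDUE_g10.md`). These two
   pure inequalities are the recommended CONJECTURE items.

HONEST FRAMING: nothing is closed or credited (the registered S3/S3ns are the bundled forms; this file only shows bundled ⟸ atoms).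
No summit statement is proved; BSD is proved for no curve.

References: [Venerucci2016] Thm. A, Thm. B; [BertoliniDarmonVenerucci2022] Thm. A; [Kim2022] Thm. 2.1, Cor. 2.3; [GrossZagier1986]
Thm. I.(7.3); [PerrinRiou1993AIF] Lemme 2.3.9, §3.3; [KuriharaPollack2007] Lemma 1.4; [Kato2004Asterisque] §8.2, Thm. 12.5 (4);
[BlochKato1990] Ex. 3.11; [SilvermanAEC2009] IV.6.4, VII.6.3, VIII.6.7; [Darmon2004] Thm. 3.22.
-/

-- the summit and its single problem are both named `BirchSwinnertonDyer` (registry layout D-0017)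
set_option linter.dupNamespace false
set_option autoImplicit false

noncomputable section

open scoped Classical
open Field WeierstrassCurve
open Literature.NumberTheory.GaloisRepresentations
open Literature.NumberTheory.EllipticCurves Literature.NumberTheory.EllipticCurves.Kato2004
open Literature.NumberTheory.EllipticCurves.Kato2004.EulerSystemValues
open Literature.NumberTheory.EllipticCurves.Rank1Residual
open Literature.NumberTheory.EllipticCurves.Rank1Residual.Typed
open Summit.BirchSwinnertonDyer.Rank1Residual
open Summit.BirchSwinnertonDyer.Rank1Residual.Additive

namespace Summit.BirchSwinnertonDyer.BirchSwinnertonDyer.Theorems.ErratumRoadFiveKatoFframeValueAtoms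

/-! ## §1 The bottom class of a pinned Iwasawa cohomology is Kummer at `p` in positive rank -/

/-- **A point of infinite order gives an integral class with a Kummer localisation of NON-ZERO logarithm** (every globally
minimal `W/ℚ`, every `p`): `x = p^c • κ_∞(P)` (the `T_p`-adic Kummer class made integral by the Tamagawa exponent) with
`t = log_ω(p^c • P) ≠ 0` — `log_ω` kills only torsion on `E(ℚ_p)` and `E(ℚ) → E(ℚ_p)` is injective. (Same proof as the route-bound
`DerivedKatoValuationDoor.exists_integral_hasLocPKummerLog_ne_zero_of_not_isOfFinAddOrder`, restated route-free.)
[cite: BlochKato1990, Ex. 3.11] [cite: Kato2004Asterisque, §14.1 (p. 235)] [cite: SilvermanAEC2009, IV.6.4 and VII.6.3] -/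
theorem exists_integral_hasLocPKummerLog_ne_zero (W : WeierstrassCurve ℚ) [W.IsElliptic] [W.IsGloballyMinimal] (p : ℕ)
    [Fact p.Prime] [ContinuousSMul ℤ_[p] (W.tateModule p)] {P : W.toAffine.Point} (hP : ¬ IsOfFinAddOrder P) :
    ∃ (x : H1 (tateRep W p) ⊤) (t : ℚ_[p]), x ∈ integralH1 (tateRep W p) p ⊤ ∧ t ≠ 0 ∧ HasLocPKummerLog W p x t := by
  obtain ⟨c, κ, -, hκ⟩ := GlobalKummer.exists_pow_smul_kummerTate_mem_integralH1_hasLocPKummerLog W p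
  obtain ⟨hint, -, hlog⟩ := hκ P
  refine ⟨p ^ c • κ P, _, hint, ?_, hlog⟩
  intro h0
  have hloc := CongruentShaFreeCutKatoKummerLogTorsion.isOfFinAddOrder_of_padicLogLocal_eq_zero W p h0
  have hpc : IsOfFinAddOrder (p ^ c • P) :=
    ((WeierstrassCurve.Affine.Point.map_injective
      (W' := W.toAffine) (f := Algebra.ofId ℚ ℚ_[p])).isOfFinAddOrder_iff).mp hloc
  exact hP (hpc.of_nsmul (pow_ne_zero c (Fact.out : p.Prime).ne_zero))

/-- **In positive rank the bottom layer of ANY `z₀ ∈ 𝐇¹_Γ` has a Kummer logarithm at `p`**: the bottom class is integral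
(`Kato2004.layerZeroToTop_mem_integralH1`), and once ONE integral class has a Kummer localisation of non-zero logarithm (§1, from a
rational point of infinite order, AEC VIII.6.7) EVERY integral class is Kummer at `p` (the Kurihara–Pollack line,
`LocPKummer.hasLocPKummerLog_of_exists_log_ne_zero_of_mem_integralH1`). No reciprocity law, no admissibility needed.
[cite: PerrinRiou1993AIF, Lemme 2.3.9 (p. 967)] [cite: KuriharaPollack2007, §1.4 Lemma 1.4] [cite: Kato2004Asterisque, §8.2 and Lemma 8.5 (pp. 180–184)] -/
theorem exists_hasLocPKummerLog_bottomClass (W : WeierstrassCurve ℚ) [W.IsElliptic] [W.IsGloballyMinimal] (p : ℕ)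
    [Fact p.Prime] [ContinuousSMul ℤ_[p] (W.tateModule p)] (hr : W.mordellWeilRank ≠ 0)
    (K : ZpExtension ℚ p) {γ : absoluteGaloisGroup ℚ} (I : IwasawaH1Data W p K γ) (z₀ : I.H) :
    ∃ t : ℚ_[p], HasLocPKummerLog W p (layerZeroToTop W p K (I.proj 0 z₀)) t := by
  obtain ⟨P, hP⟩ := W.exists_not_isOfFinAddOrder_of_mordellWeilRank_ne_zero hr
  exact LocPKummer.hasLocPKummerLog_of_exists_log_ne_zero_of_mem_integralH1 W p
    (exists_integral_hasLocPKummerLog_ne_zero W p hP) (layerZeroToTop_mem_integralH1 W p K (I.proj_mem 0 z₀))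

/-! ## §2 The registered stubs S3 / S3ns (signatures with `bottomClass`/`logOmega` unfolded) from their atoms -/

/-- **S3 (`stub_integralExcZeroValue`) from its atoms**: GZ86 I.(7.3) + GZK give the rational `q = #Ш_an`
(`Disegni2020.exists_rat_shaAn_eq_of_analyticRank_eq_one`); §1 gives a Kummer logarithm `t` of the bottom class; `hNZsplit`
(Venerucci 2016 Thm. A (2)/B — print) gives `t ≠ 0`; `hVsplit` is the pure valuation inequality (research).
[cite: Venerucci2016, Thm. A and Thm. B] [cite: GrossZagier1986, Thm. I.(7.3)] [cite: Darmon2004, Thm. 3.22] -/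
theorem integralExcZeroValue_of_atoms (hGZK : rank_eq_analyticRank_of_analyticRank_le_one) (hGZ : GrossZagier1986_thm_I_7_3)
    (hNZsplit : ∀ (W : WeierstrassCurve ℚ) [W.IsElliptic] [W.IsGloballyMinimal] (p : ℕ) [Fact p.Prime]
      [ContinuousSMul ℤ_[p] (W.tateModule p)],
      5 ≤ p → Surj W p → W.analyticRank = 1 → W.HasSplitMultiplicativeReductionAtPrime p →
      ∀ (K : ZpExtension ℚ p) (hK : K.IsCyclotomic) (γ : absoluteGaloisGroup ℚ)
        (I : IwasawaH1Data W p K γ) (z₀ : I.H), K.IsTopGenerator γ → IsAdmissibleZetaClass W p K hK I z₀ →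
      ∀ t : ℚ_[p], HasLocPKummerLog W p (layerZeroToTop W p K (I.proj 0 z₀)) t → t ≠ 0)
    (hVsplit : ∀ (W : WeierstrassCurve ℚ) [W.IsElliptic] [W.IsGloballyMinimal] (p : ℕ) [Fact p.Prime]
      [ContinuousSMul ℤ_[p] (W.tateModule p)],
      ClassX11b W p → 5 ≤ p → Surj W p → W.HasSplitMultiplicativeReductionAtPrime p →
      ∀ (h1 : W.mordellWeilRank = 1) (P : Fin W.mordellWeilRank → W.toAffine.Point),
        W.IsMordellWeilBasis P →
      ∀ (K : ZpExtension ℚ p) (hK : K.IsCyclotomic) (γ : absoluteGaloisGroup ℚ)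
        (I : IwasawaH1Data W p K γ) (z₀ : I.H), K.IsTopGenerator γ → IsAdmissibleZetaClass W p K hK I z₀ →
      ∀ t : ℚ_[p], HasLocPKummerLog W p (layerZeroToTop W p K (I.proj 0 z₀)) t → t ≠ 0 →
      ∀ q : ℚ, shaAn W = (q : ℂ) →
        t.valuation -
            2 * (padicLogLocal W p (WeierstrassCurve.Affine.Point.map (Algebra.ofId ℚ ℚ_[p]) (P (Fin.cast h1.symm 0)))).valuation ≤
          padicValRat p q + padicValNat p W.tamagawaProduct - 2 * padicValNat p W.torsionOrder - 1) :
    ∀ (W : WeierstrassCurve ℚ) [W.IsElliptic] [W.IsGloballyMinimal] (p : ℕ) [Fact p.Prime]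
      [ContinuousSMul ℤ_[p] (W.tateModule p)],
      ClassX11b W p → 5 ≤ p → Surj W p → W.HasSplitMultiplicativeReductionAtPrime p →
      ∀ (h1 : W.mordellWeilRank = 1) (P : Fin W.mordellWeilRank → W.toAffine.Point),
        W.IsMordellWeilBasis P →
      ∀ (K : ZpExtension ℚ p) (hK : K.IsCyclotomic) (γ : absoluteGaloisGroup ℚ)
        (I : IwasawaH1Data W p K γ) (z₀ : I.H), K.IsTopGenerator γ → IsAdmissibleZetaClass W p K hK I z₀ →
      ∃ (q : ℚ) (t : ℚ_[p]), shaAn W = (q : ℂ) ∧ HasLocPKummerLog W p (layerZeroToTop W p K (I.proj 0 z₀)) t ∧ t ≠ 0 ∧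
        t.valuation -
            2 * (padicLogLocal W p (WeierstrassCurve.Affine.Point.map (Algebra.ofId ℚ ℚ_[p]) (P (Fin.cast h1.symm 0)))).valuation ≤
          padicValRat p q + padicValNat p W.tamagawaProduct - 2 * padicValNat p W.torsionOrder - 1 := by
  intro W _ _ p _ _ hX h5 hSurj hsplit h1 P hP K hK γ I z₀ hγ hz
  have hr1 : W.analyticRank = 1 := hX.1
  obtain ⟨q, hq⟩ := Disegni2020.exists_rat_shaAn_eq_of_analyticRank_eq_one hGZ hGZK W hr1
  obtain ⟨t, ht⟩ := exists_hasLocPKummerLog_bottomClass W p (by omega) K I z₀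
  have ht0 : t ≠ 0 := hNZsplit W p h5 hSurj hr1 hsplit K hK γ I z₀ hγ hz t ht
  exact ⟨q, t, hq, ht, ht0, hVsplit W p hX h5 hSurj hsplit h1 P hP K hK γ I z₀ hγ hz t ht ht0 q hq⟩

/-- **S3ns (`stub_integralNonsplitValue`) from its atoms**: as `integralExcZeroValue_of_atoms`, with `hNZnonsplit`
(Bertolini–Darmon–Venerucci 2022 Thm. A at a non-split multiplicative `p`, `p² ∤ N` — print) and `hVnonsplit` (research); multiplicative
reduction at `p` is part of `ClassX11b`. [cite: BertoliniDarmonVenerucci2022, Thm. A] [cite: Kim2022, Thm. 2.1 and Cor. 2.3]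
[cite: GrossZagier1986, Thm. I.(7.3)] [cite: Darmon2004, Thm. 3.22] -/
theorem integralNonsplitValue_of_atoms (hGZK : rank_eq_analyticRank_of_analyticRank_le_one) (hGZ : GrossZagier1986_thm_I_7_3)
    (hNZnonsplit : ∀ (W : WeierstrassCurve ℚ) [W.IsElliptic] [W.IsGloballyMinimal] (p : ℕ) [Fact p.Prime]
      [ContinuousSMul ℤ_[p] (W.tateModule p)],
      5 ≤ p → Surj W p → W.analyticRank = 1 → W.HasMultiplicativeReductionAtPrime p →
      ¬ W.HasSplitMultiplicativeReductionAtPrime p →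
      ∀ (K : ZpExtension ℚ p) (hK : K.IsCyclotomic) (γ : absoluteGaloisGroup ℚ)
        (I : IwasawaH1Data W p K γ) (z₀ : I.H), K.IsTopGenerator γ → IsAdmissibleZetaClass W p K hK I z₀ →
      ∀ t : ℚ_[p], HasLocPKummerLog W p (layerZeroToTop W p K (I.proj 0 z₀)) t → t ≠ 0)
    (hVnonsplit : ∀ (W : WeierstrassCurve ℚ) [W.IsElliptic] [W.IsGloballyMinimal] (p : ℕ) [Fact p.Prime]
      [ContinuousSMul ℤ_[p] (W.tateModule p)],
      ClassX11b W p → 5 ≤ p → Surj W p → ¬ W.HasSplitMultiplicativeReductionAtPrime p →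
      ∀ (h1 : W.mordellWeilRank = 1) (P : Fin W.mordellWeilRank → W.toAffine.Point),
        W.IsMordellWeilBasis P →
      ∀ (K : ZpExtension ℚ p) (hK : K.IsCyclotomic) (γ : absoluteGaloisGroup ℚ)
        (I : IwasawaH1Data W p K γ) (z₀ : I.H), K.IsTopGenerator γ → IsAdmissibleZetaClass W p K hK I z₀ →
      ∀ t : ℚ_[p], HasLocPKummerLog W p (layerZeroToTop W p K (I.proj 0 z₀)) t → t ≠ 0 →
      ∀ q : ℚ, shaAn W = (q : ℂ) →
        t.valuation -
            2 * (padicLogLocal W p (WeierstrassCurve.Affine.Point.map (Algebra.ofId ℚ ℚ_[p]) (P (Fin.cast h1.symm 0)))).valuation ≤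
          padicValRat p q + padicValNat p W.tamagawaProduct - 2 * padicValNat p W.torsionOrder - 1) :
    ∀ (W : WeierstrassCurve ℚ) [W.IsElliptic] [W.IsGloballyMinimal] (p : ℕ) [Fact p.Prime]
      [ContinuousSMul ℤ_[p] (W.tateModule p)],
      ClassX11b W p → 5 ≤ p → Surj W p → ¬ W.HasSplitMultiplicativeReductionAtPrime p →
      ∀ (h1 : W.mordellWeilRank = 1) (P : Fin W.mordellWeilRank → W.toAffine.Point),
        W.IsMordellWeilBasis P →
      ∀ (K : ZpExtension ℚ p) (hK : K.IsCyclotomic) (γ : absoluteGaloisGroup ℚ)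
        (I : IwasawaH1Data W p K γ) (z₀ : I.H), K.IsTopGenerator γ → IsAdmissibleZetaClass W p K hK I z₀ →
      ∃ (q : ℚ) (t : ℚ_[p]), shaAn W = (q : ℂ) ∧ HasLocPKummerLog W p (layerZeroToTop W p K (I.proj 0 z₀)) t ∧ t ≠ 0 ∧
        t.valuation -
            2 * (padicLogLocal W p (WeierstrassCurve.Affine.Point.map (Algebra.ofId ℚ ℚ_[p]) (P (Fin.cast h1.symm 0)))).valuation ≤
          padicValRat p q + padicValNat p W.tamagawaProduct - 2 * padicValNat p W.torsionOrder - 1 := by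
  intro W _ _ p _ _ hX h5 hSurj hns h1 P hP K hK γ I z₀ hγ hz
  have hr1 : W.analyticRank = 1 := hX.1
  have hmult : W.HasMultiplicativeReductionAtPrime p := hX.2.2.1
  obtain ⟨q, hq⟩ := Disegni2020.exists_rat_shaAn_eq_of_analyticRank_eq_one hGZ hGZK W hr1
  obtain ⟨t, ht⟩ := exists_hasLocPKummerLog_bottomClass W p (by omega) K I z₀
  have ht0 : t ≠ 0 := hNZnonsplit W p h5 hSurj hr1 hmult hns K hK γ I z₀ hγ hz t ht
  exact ⟨q, t, hq, ht, ht0, hVnonsplit W p hX h5 hSurj hns h1 P hP K hK γ I z₀ hγ hz t ht ht0 q hq⟩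

end Summit.BirchSwinnertonDyer.BirchSwinnertonDyer.Theorems.ErratumRoadFiveKatoFframeValueAtoms

end
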